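import Summits.QuantumAdvantage.QuantumAdvantage.Theses.CubicForrelation
import Summits.QuantumAdvantage.QuantumAdvantage.Theorems.CubicStability.Negative.WithoutEven
import Literature.Computability.QuantumComplexity.ForrelationDerivativeTables
import Summits.QuantumAdvantage.QuantumAdvantage.Theorems.CubicForrelationInPrBPP.Negative.SignedSlice

/-!
# Refutation of `CubicForrelation.CubicStability` (stmt-QuantumAdvantage-2202)

The crux asserts: for even `n` and cubic `f, g` with `Φ(f,g) ≥ 3/5` there is an EXACTLY
forrelated cubic pair `(f₀, g₀)` (`Φ = 1`) within relative Hamming distance `1/4` of `(f, g)` on both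
sides.  It is false at `n = 12`.

**Witness `P₄`.**  Group the 12 coordinates into 4 blocks of 3 and put
`b(x) = ∑_k x^k₁ x^k₂ x^k₃` (four disjoint cubes), `a(x) = ∑_k [wt(x^k) = 2]`; both have ANF degree 3.
Per block, `W_{c₃} = (6; ∓2)` and `(-1)^{[wt = 2]}` is exactly its sign pattern, so
`Φ = (20 / 2^{9/2})^4 = 160000 / 2^18 = 625/1024 ≥ 3/5` (YES).  But NO bent function on `𝔽₂¹²` lies
within Hamming distance `1024 = 2ⁿ/4` of `b`: if `Φ(f₀,g₀) = 1` then `g₀` is bent with dual `f₀`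
(Cauchy–Schwarz), `f₀` is bent, and writing `ρ = (-1)^{a + f₀}` the closeness of `g₀` to `b` reads
`∑_u (1 - ρ(u)) w(u) ≤ 28928` with `w(u) = 6^{z(u)} 2^{4-z(u)}` (`z(u)` = number of zero blocks of
`u`), while `|W_{f₀}| ≤ 64` at the 29 points `1¹²`, `1¹² ⊕ e(k,v̄)` forces
`∑_u (1-ρ(u)) z(u) [z(u) odd] ≥ 608`, hence `∑_u (1-ρ(u)) w(u) ≥ 48 · 608 = 29184 > 28928`.
(crux-triage seat refuter-cruxtri-stmt-QuantumAdvantage-2202-r1-3-0, 2026-08-16; paper proof and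
machine checks: Cruxes/CubicStability/Counterexample-P4.md, kit j007630.)

Classification: refuted-substantive for the filed constants `(3/5, 1/4)` — the witness is a genuine
'sporadic forrelated cubic pair far from every bent/dual pair'; the cheapest repair it misses is a
YES threshold `θ > 625/1024` (e.g. `2/3`), whose truth is open.
-/

noncomputable section

open Finset
open Literature.Computability.QuantumComplexity
open Literature.Computability.QuantumComplexity.DerivativeWalsh (W fsum fsum_eq_sum_mul_W)
open Literature.Computability.QuantumComplexity.BuzetChailloux (bxor twist_bxor_right phi phi_signOf
  zeroVec sum_twist_left)
open Literature.Computability.QuantumComplexity.Simon (twist_mul_self twist_xor_left sum_twist)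
open Summit.QuantumAdvantage.QuantumAdvantage.Theorems.CubicForrelationInPrBPP.Negative (sum_W_sq_of_sq)
open Literature.Computability.QuantumComplexity.BuzetChailloux (signOf_sq)

namespace Summit.QuantumAdvantage.QuantumAdvantage.Theorems

namespace CubicStabilityRefutation

/-! ### Generic Walsh analysis on `𝔽₂ⁿ` (real `±1`-valued functions) -/

section Walsh

variable {n : ℕ}

/-- Fourier inversion: `∑_x (-1)^{u·x} W_h(x) = 2ⁿ h(u)`. [folklore] -/
theorem sum_twist_mul_W (h : (Fin n → Bool) → ℝ) (u : Fin n → Bool) :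
    ∑ x, twist u x * W h x = (2 : ℝ) ^ n * h u := by
  have step : ∀ x : Fin n → Bool, twist u x * W h x = ∑ y, h y * twist (fun i => u i ^^ y i) x := by
    intro x
    rw [W, mul_sum]
    refine sum_congr rfl fun y _ => ?_
    rw [twist_xor_left]
    ring
  rw [sum_congr rfl fun x _ => step x, sum_comm]
  have key : ∀ y : Fin n → Bool, ((fun i => u i ^^ y i) = fun _ => false) ↔ y = u := by
    intro y
    constructor
    · intro hxy
      funext i
      have hi : (u i ^^ y i) = false := congrFun hxy i
      revert hi
      cases u i <;> cases y i <;> simp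
    · rintro rfl
      funext i
      exact Bool.xor_self _
  have inner : ∀ y : Fin n → Bool,
      ∑ x, h y * twist (fun i => u i ^^ y i) x = h y * (if y = u then (2 : ℝ) ^ n else 0) := by
    intro y
    rw [← mul_sum, sum_twist]
    congr 1
    exact if_congr (key y) rfl rfl
  rw [sum_congr rfl fun y _ => inner y]
  simp_rw [mul_ite, mul_zero, Finset.sum_ite_eq' univ, if_pos (mem_univ _)]
  ring

/-- Plancherel: `∑_x W_g(x) W_{g'}(x) = 2ⁿ ∑_y g(y) g'(y)`. [folklore] -/
theorem sum_W_mul_W (g g' : (Fin n → Bool) → ℝ) :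
    ∑ x, W g x * W g' x = (2 : ℝ) ^ n * ∑ y, g y * g' y := by
  have step : ∀ x : Fin n → Bool, W g x * W g' x = ∑ y, g' y * (twist y x * W g x) := by
    intro x
    rw [show W g' x = ∑ y, g' y * twist y x from rfl, mul_sum]
    exact sum_congr rfl fun y _ => by ring
  rw [sum_congr rfl fun x _ => step x, sum_comm, mul_sum]
  refine sum_congr rfl fun y _ => ?_
  rw [← mul_sum, sum_twist_mul_W]
  ring

/-- Parseval for a `±1`-valued function: `∑_x W_h(x)² = 4ⁿ`. [folklore] -/
theorem sum_W_sq (h : (Fin n → Bool) → ℝ) (hh : ∀ y, h y ^ 2 = 1) :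
    ∑ x, W h x ^ 2 = (2 : ℝ) ^ n * 2 ^ n := by
  simp_rw [sq]
  rw [sum_W_mul_W]
  simp_rw [← sq, hh]
  simp only [sum_const, card_univ, Fintype.card_fun, Fintype.card_bool, Fintype.card_fin,
    nsmul_eq_mul, mul_one]
  push_cast
  ring

/-- `∑_x f(x)² = 2ⁿ` for a `±1`-valued `f`. [folklore] -/
theorem sum_sq_eq (f : (Fin n → Bool) → ℝ) (hf : ∀ x, f x ^ 2 = 1) : ∑ x, f x ^ 2 = (2 : ℝ) ^ n := by
  simp_rw [hf]
  simp only [sum_const, card_univ, Fintype.card_fun, Fintype.card_bool, Fintype.card_fin,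
    nsmul_eq_mul, mul_one]
  push_cast
  ring

/-- Cauchy–Schwarz equality: if `∑_x f(x) W_g(x) = c · 2ⁿ` with `c² = 2ⁿ` for `±1`-valued `f, g`,
then `W_g = c · f` pointwise (`g` is bent with dual `f`). [folklore] -/
theorem W_eq_of_fsum_eq (f g : (Fin n → Bool) → ℝ) (hf : ∀ x, f x ^ 2 = 1) (hg : ∀ y, g y ^ 2 = 1)
    (c : ℝ) (hc : c ^ 2 = (2 : ℝ) ^ n) (hS : ∑ x, f x * W g x = c * 2 ^ n) :
    ∀ x, W g x = c * f x := by
  have e : ∀ x, (W g x - c * f x) ^ 2 = W g x ^ 2 - 2 * c * (f x * W g x) + c ^ 2 * f x ^ 2 := by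
    intro x; ring
  have h1 : ∑ x, (W g x - c * f x) ^ 2 =
      ∑ x, W g x ^ 2 - 2 * c * ∑ x, f x * W g x + c ^ 2 * ∑ x, f x ^ 2 := by
    simp_rw [e]
    rw [sum_add_distrib, sum_sub_distrib, ← mul_sum, ← mul_sum]
  have hsum : ∑ x, (W g x - c * f x) ^ 2 = 0 := by
    rw [h1, sum_W_sq_of_sq g hg, hS, sum_sq_eq f hf]
    linear_combination (-(2 : ℝ) ^ n) * hc
  intro x
  have hx := (sum_eq_zero_iff_of_nonneg (fun y _ => sq_nonneg (W g y - c * f y))).1 hsum x (mem_univ x)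
  have : W g x - c * f x = 0 := pow_eq_zero_iff (n := 2) (by norm_num) |>.1 hx
  linarith

/-- The dual of a bent function is bent: if `W_g = c · f` with `c² = 2ⁿ`, `c ≠ 0`, then
`W_f = c · g`. [folklore] -/
theorem W_dual (f g : (Fin n → Bool) → ℝ) (c : ℝ) (hc : c ^ 2 = (2 : ℝ) ^ n) (hc0 : c ≠ 0)
    (hW : ∀ x, W g x = c * f x) : ∀ u, W f u = c * g u := by
  intro u
  have h1 : c * W f u = ∑ x, twist u x * W g x := by
    rw [show W f u = ∑ x, f x * twist x u from rfl, mul_sum]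
    refine sum_congr rfl fun x _ => ?_
    rw [hW x, twist_comm]
    ring
  rw [sum_twist_mul_W, ← hc] at h1
  have : c * (W f u - c * g u) = 0 := by rw [mul_sub, h1]; ring
  rcases mul_eq_zero.1 this with h | h
  · exact absurd h hc0
  · linarith

/-- Correlation versus Hamming distance for Boolean functions:
`2ⁿ = ∑_y (-1)^{g(y)} (-1)^{g₀(y)} + 2 · #{g ≠ g₀}`. [folklore] -/
theorem two_pow_eq_corr_add (g g₀ : (Fin n → Bool) → Bool) :
    (2 : ℝ) ^ n = ∑ y, signOf (g y) * signOf (g₀ y) + 2 * (CubicStability.Negative.hdist g g₀ : ℝ) := by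
  unfold CubicStability.Negative.hdist
  have e : ∀ y : Fin n → Bool,
      signOf (g y) * signOf (g₀ y) = 1 - 2 * (if g y ≠ g₀ y then 1 else 0) := by
    intro y
    cases g y <;> cases g₀ y <;> norm_num [signOf]
  simp_rw [e, sum_sub_distrib, ← mul_sum]
  rw [sum_boole]
  simp only [sum_const, card_univ, Fintype.card_fun, Fintype.card_bool, Fintype.card_fin,
    nsmul_eq_mul, mul_one]
  push_cast
  ring

/-- `signOf b = ±1`, squared. [folklore] -/
theorem signOf_sq' (b : Bool) : signOf b ^ 2 = 1 := by cases b <;> norm_num [signOf]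

/-- `|signOf b| ≤ 1` in the two directions we use. [folklore] -/
theorem signOf_le_one (b : Bool) : signOf b ≤ 1 := by cases b <;> norm_num [signOf]

theorem neg_one_le_signOf (b : Bool) : -1 ≤ signOf b := by cases b <;> norm_num [signOf]

/-- `signOf (a ⊕ b) = signOf a · signOf b`. [folklore] -/
theorem signOf_xor (a b : Bool) : signOf (a ^^ b) = signOf a * signOf b := by
  cases a <;> cases b <;> norm_num [signOf]

end Walsh

/-! ### Four blocks of three bits -/

/-- A block of three bits. -/
abbrev V := Fin 3 → Bool

/-- The index of bit `j` of block `k`. -/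
def ix (k : Fin 4) (j : Fin 3) : Fin (4 * 3) := finProdFinEquiv (k, j)

/-- Block `k` of a 12-bit vector. -/
def blk (u : Fin (4 * 3) → Bool) (k : Fin 4) : V := fun j => u (ix k j)

/-- 12-bit vectors as 4-tuples of blocks. [folklore] -/
def eBlk : (Fin (4 * 3) → Bool) ≃ (Fin 4 → V) :=
  ((Equiv.arrowCongr finProdFinEquiv (Equiv.refl Bool)).symm).trans (Equiv.curry _ _ _)

@[simp] theorem eBlk_apply (u : Fin (4 * 3) → Bool) : eBlk u = blk u := rfl

theorem blk_eBlk_symm (U : Fin 4 → V) : blk (eBlk.symm U) = U := by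
  rw [← eBlk_apply, Equiv.apply_symm_apply]

/-- The twist factorises over the blocks. [folklore] -/
theorem twist_blocks (u v : Fin (4 * 3) → Bool) : twist u v = ∏ k, twist (blk u k) (blk v k) := by
  unfold twist
  rw [← Fintype.prod_equiv finProdFinEquiv
      (fun p : Fin 4 × Fin 3 => if u (finProdFinEquiv p) && v (finProdFinEquiv p) then (-1 : ℝ) else 1)
      _ (fun _ => rfl), Fintype.prod_prod_type]
  rfl

/-- Tensor sums: `∑_u ∏_k F_k(u^k) = ∏_k ∑_v F_k(v)`. [folklore] -/
theorem sum_prod_blocks (F : Fin 4 → V → ℝ) :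
    ∑ u : Fin (4 * 3) → Bool, ∏ k, F k (blk u k) = ∏ k, ∑ v : V, F k v := by
  rw [Fintype.prod_sum]
  rw [← eBlk.symm.sum_comp]
  refine sum_congr rfl fun U _ => ?_
  rw [blk_eBlk_symm]

/-- Walsh transform of a block-product function is the product of the block transforms. [folklore] -/
theorem W_blocks (h : Fin 4 → V → ℝ) (x : Fin (4 * 3) → Bool) :
    W (fun u => ∏ k, h k (blk u k)) x = ∏ k, W (h k) (blk x k) := by
  rw [show W (fun u => ∏ k, h k (blk u k)) x = ∑ u, (∏ k, h k (blk u k)) * twist u x from rfl]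
  simp_rw [twist_blocks, ← prod_mul_distrib]
  have key := sum_prod_blocks (fun k v => h k v * twist v (blk x k))
  rw [key]
  rfl

/-! ### Three-bit facts -/

/-- The zero block. -/
def zero3 : V := fun _ => false

/-- The all-ones block. -/
def ones3 : V := fun _ => true

/-- `[wt(a,b,c) = 2]`. -/
def s3b (a b c : Bool) : Bool := (a && b && !c) || (a && !b && c) || (!a && b && c)

/-- `[wt(v) = 2]` on a block. -/
def s3 (v : V) : Bool := s3b (v 0) (v 1) (v 2)

/-- The cube `v₀ v₁ v₂` on a block. -/
def c3 (v : V) : Bool := v 0 && v 1 && v 2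

/-- Blocks as triples of bits. [folklore] -/
def eV : V ≃ Bool × Bool × Bool where
  toFun v := (v 0, v 1, v 2)
  invFun p := ![p.1, p.2.1, p.2.2]
  left_inv v := by
    funext j
    fin_cases j <;> rfl
  right_inv p := by
    obtain ⟨a, b, c⟩ := p
    rfl

theorem sum_V (F : V → ℝ) : ∑ v, F v = ∑ a : Bool, ∑ b : Bool, ∑ c : Bool, F ![a, b, c] := by
  rw [← eV.symm.sum_comp, Fintype.sum_prod_type]
  refine sum_congr rfl fun a _ => ?_
  rw [Fintype.sum_prod_type]
  rfl

theorem forall_V {P : V → Prop} : (∀ v, P v) ↔ ∀ a b c : Bool, P ![a, b, c] := by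
  constructor
  · intro h a b c; exact h _
  · intro h v
    have := h (v 0) (v 1) (v 2)
    have hv : (![v 0, v 1, v 2] : V) = v := eV.left_inv v
    rwa [hv] at this

theorem vec3_eq_iff (a b c : Bool) (w : V) : ((![a, b, c] : V) = w) ↔ (a = w 0 ∧ b = w 1 ∧ c = w 2) := by
  constructor
  · rintro rfl; exact ⟨rfl, rfl, rfl⟩
  · rintro ⟨h0, h1, h2⟩
    funext j
    fin_cases j
    · exact h0
    · exact h1
    · exact h2

theorem twist_V (v w : V) : twist v w =
    (if v 0 && w 0 then -1 else 1) * (if v 1 && w 1 then -1 else 1) * (if v 2 && w 2 then -1 else 1) := by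
  unfold twist
  rw [Fin.prod_univ_three]

/-- `ε(v) := (-1)^{[wt v = 2]} (-1)^{wt v}` equals `+1` at `v = 0` and `-1` otherwise. [folklore] -/
def eps (v : V) : ℝ := if v = zero3 then 1 else -1

theorem eps_eq (v : V) : signOf (s3 v) * twist v ones3 = eps v := by
  revert v
  rw [forall_V]
  intro a b c
  unfold eps
  rw [twist_V]
  simp only [s3, s3b, ones3, zero3, Matrix.cons_val_zero, Matrix.cons_val_one, Matrix.head_cons,
    Matrix.cons_val_two, Matrix.tail_cons, Bool.and_true, vec3_eq_iff]
  cases a <;> cases b <;> cases c <;> norm_num [signOf]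

theorem card_V : Fintype.card V = 8 := by simp

/-- `∑_v (if v = 0 then A else B) = A + 7B` on a block. [folklore] -/
theorem sum_ite_zero3 (A B : ℝ) : ∑ v : V, (if v = zero3 then A else B) = A + 7 * B := by
  have e : (fun v : V => if v = zero3 then A else B) = fun v => B + (if v = zero3 then A - B else 0) := by
    funext v; split_ifs <;> ring
  rw [e, sum_add_distrib, sum_ite_eq' univ, if_pos (mem_univ _)]
  simp only [sum_const, card_univ, card_V, nsmul_eq_mul]
  push_cast; ring

theorem sum_eps : ∑ v : V, eps v = -6 := by
  unfold eps; rw [sum_ite_zero3]; norm_num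

theorem twist_zero3_left (w : V) : twist zero3 w = 1 := by
  unfold twist zero3; simp

theorem twist_zero3_right (w : V) : twist w zero3 = 1 := by
  rw [twist_comm]; exact twist_zero3_left w

/-- `∑_v ε(v) (-1)^{v·w} = 2` for `w ≠ 0`. [folklore] -/
theorem sum_eps_twist (w : V) (hw : w ≠ zero3) : ∑ v : V, eps v * twist v w = 2 := by
  have e : ∀ v : V, eps v * twist v w = -twist v w + (if v = zero3 then 2 * twist v w else 0) := by
    intro v; unfold eps; split_ifs <;> ring
  simp_rw [e]
  rw [sum_add_distrib, sum_ite_eq' univ, if_pos (mem_univ _), sum_neg_distrib, twist_zero3_left]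
  have hs := sum_twist_left (n := 3) w
  rw [if_neg (show w ≠ zeroVec from hw)] at hs
  rw [hs]; norm_num

/-- `∑_{w ≠ 0} (-1)^{v·w} = 8[v = 0] - 1`. [folklore] -/
theorem sum_twist_erase (v : V) :
    ∑ w ∈ univ.erase zero3, twist v w = (if v = zero3 then 8 else 0) - 1 := by
  rw [sum_erase_eq_sub (mem_univ _), twist_zero3_right, sum_twist,
    show ((fun _ => false) : V) = zero3 from rfl]
  norm_num

/-- The Walsh transform of the signed cube on a block: `8[v = 0] - 2 (-1)^{wt v}`. [folklore] -/
theorem W_c3 (v : V) : W (fun y => signOf (c3 y)) v = (if v = zero3 then 8 else 0) - 2 * twist ones3 v := by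
  have e : ∀ y : V, signOf (c3 y) = 1 + (if y = ones3 then -2 else 0) := by
    rw [forall_V]
    intro a b c
    simp only [c3, ones3, Matrix.cons_val_zero, Matrix.cons_val_one, Matrix.head_cons,
      Matrix.cons_val_two, Matrix.tail_cons, vec3_eq_iff]
    cases a <;> cases b <;> cases c <;> norm_num [signOf]
  rw [show W (fun y => signOf (c3 y)) v = ∑ y, signOf (c3 y) * twist y v from rfl]
  simp_rw [e, add_mul, one_mul, sum_add_distrib, ite_mul, zero_mul, sum_ite_eq' univ, if_pos (mem_univ _)]
  rw [sum_twist_left]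
  have : (zeroVec : V) = zero3 := rfl
  rw [this]
  norm_num
  ring

/-- The block weight `m(v) = (-1)^{[wt v = 2]} W_{c₃}(v) ∈ {6, 2}`. [folklore] -/
def mV (v : V) : ℝ := if v = zero3 then 6 else 2

theorem mV_eq (v : V) : signOf (s3 v) * W (fun y => signOf (c3 y)) v = mV v := by
  rw [W_c3]
  unfold mV
  by_cases hv : v = zero3
  · subst hv
    simp [s3, s3b, zero3, signOf, twist_zero3_right]
    norm_num
  · rw [if_neg hv, if_neg hv]
    have h := eps_eq v
    unfold eps at h
    rw [if_neg hv, twist_comm] at h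
    linear_combination (-2) * h

theorem sum_mV : ∑ v : V, mV v = 20 := by
  unfold mV; rw [sum_ite_zero3]; norm_num

/-! ### The witness pair on 12 bits -/

/-- `a(u) = ∑_k [wt(u^k) = 2]` (mod 2). -/
def fA (u : Fin (4 * 3) → Bool) : Bool := s3 (blk u 0) ^^ s3 (blk u 1) ^^ s3 (blk u 2) ^^ s3 (blk u 3)

/-- `b(u) = ∑_k u^k₀ u^k₁ u^k₂` (mod 2). -/
def gB (u : Fin (4 * 3) → Bool) : Bool := c3 (blk u 0) ^^ c3 (blk u 1) ^^ c3 (blk u 2) ^^ c3 (blk u 3)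

theorem sf_eq (u : Fin (4 * 3) → Bool) : signOf (fA u) = ∏ k, signOf (s3 (blk u k)) := by
  rw [Fin.prod_univ_four]; unfold fA; rw [signOf_xor, signOf_xor, signOf_xor]

theorem sg_eq (u : Fin (4 * 3) → Bool) : signOf (gB u) = ∏ k, signOf (c3 (blk u k)) := by
  rw [Fin.prod_univ_four]; unfold gB; rw [signOf_xor, signOf_xor, signOf_xor]

/-! #### Cubicity witnesses -/

section Cubic

open MvPolynomial

/-- The cubic polynomial of block `k` for `a`: `X₀X₁ + X₀X₂ + X₁X₂ + X₀X₁X₂`. -/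
def qS (k : Fin 4) : MvPolynomial (Fin (4 * 3)) (ZMod 2) :=
  X (ix k 0) * X (ix k 1) + X (ix k 0) * X (ix k 2) + X (ix k 1) * X (ix k 2) +
    X (ix k 0) * X (ix k 1) * X (ix k 2)

/-- The cube of block `k`. -/
def qC (k : Fin 4) : MvPolynomial (Fin (4 * 3)) (ZMod 2) := X (ix k 0) * X (ix k 1) * X (ix k 2)

theorem deg_X2 (i j : Fin (4 * 3)) : (X i * X j : MvPolynomial (Fin (4 * 3)) (ZMod 2)).totalDegree ≤ 2 :=
  (totalDegree_mul _ _).trans (by rw [totalDegree_X, totalDegree_X])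

theorem deg_X3 (i j l : Fin (4 * 3)) :
    (X i * X j * X l : MvPolynomial (Fin (4 * 3)) (ZMod 2)).totalDegree ≤ 3 :=
  (totalDegree_mul _ _).trans (by
    have := deg_X2 i j
    rw [totalDegree_X]; omega)

theorem deg_qS (k : Fin 4) : (qS k).totalDegree ≤ 3 := by
  unfold qS
  refine (totalDegree_add _ _).trans (max_le ?_ (deg_X3 _ _ _))
  refine (totalDegree_add _ _).trans (max_le ?_ ((deg_X2 _ _).trans (by norm_num)))
  exact (totalDegree_add _ _).trans (max_le ((deg_X2 _ _).trans (by norm_num)) ((deg_X2 _ _).trans (by norm_num)))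

theorem deg_qC (k : Fin 4) : (qC k).totalDegree ≤ 3 := deg_X3 _ _ _

theorem deg_sum4 (q : Fin 4 → MvPolynomial (Fin (4 * 3)) (ZMod 2)) (hq : ∀ k, (q k).totalDegree ≤ 3) :
    (q 0 + q 1 + q 2 + q 3).totalDegree ≤ 3 :=
  (totalDegree_add _ _).trans (max_le ((totalDegree_add _ _).trans (max_le
    ((totalDegree_add _ _).trans (max_le (hq 0) (hq 1))) (hq 2))) (hq 3))

theorem s3b_zmod (a b c : Bool) :
    ((if a then 1 else 0) * (if b then 1 else 0) + (if a then 1 else 0) * (if c then 1 else 0) +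
      (if b then 1 else 0) * (if c then 1 else 0) +
      (if a then 1 else 0) * (if b then 1 else 0) * (if c then 1 else 0) : ZMod 2) =
      if s3b a b c then 1 else 0 := by
  cases a <;> cases b <;> cases c <;> decide

theorem c3_zmod (a b c : Bool) :
    ((if a then 1 else 0) * (if b then 1 else 0) * (if c then 1 else 0) : ZMod 2) =
      if (a && b && c) then 1 else 0 := by
  cases a <;> cases b <;> cases c <;> decide

theorem xor4_zmod (p q r s : Bool) :
    (p ^^ q ^^ r ^^ s) = decide (((if p then 1 else 0) + (if q then 1 else 0) + (if r then 1 else 0) +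
      (if s then 1 else 0) : ZMod 2) = 1) := by
  cases p <;> cases q <;> cases r <;> cases s <;> decide

theorem eval_qS (x : Fin (4 * 3) → Bool) (k : Fin 4) :
    eval (fun j => if x j then (1 : ZMod 2) else 0) (qS k) = if s3 (blk x k) then 1 else 0 := by
  simp only [qS, eval_add, eval_mul, eval_X]
  exact s3b_zmod _ _ _

theorem eval_qC (x : Fin (4 * 3) → Bool) (k : Fin 4) :
    eval (fun j => if x j then (1 : ZMod 2) else 0) (qC k) = if c3 (blk x k) then 1 else 0 := by
  simp only [qC, eval_mul, eval_X]
  exact c3_zmod _ _ _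

theorem isCubic_fA : CubicStability.Negative.IsCubic fA := by
  refine ⟨qS 0 + qS 1 + qS 2 + qS 3, deg_sum4 qS deg_qS, fun x => ?_⟩
  simp only [eval_add, eval_qS]
  exact xor4_zmod _ _ _ _

theorem isCubic_gB : CubicStability.Negative.IsCubic gB := by
  refine ⟨qC 0 + qC 1 + qC 2 + qC 3, deg_sum4 qC deg_qC, fun x => ?_⟩
  simp only [eval_add, eval_qC]
  exact xor4_zmod _ _ _ _

end Cubic

/-! #### The finite facts about the witness -/

/-- The all-ones vector `x* = 1¹²`. -/
def xstar : Fin (4 * 3) → Bool := fun _ => true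

/-- The vector with block `k` equal to `w` and the other blocks zero. -/
def emb (k : Fin 4) (w : V) : Fin (4 * 3) → Bool := eBlk.symm (fun j => if j = k then w else zero3)

theorem blk_emb (k : Fin 4) (w : V) (j : Fin 4) : blk (emb k w) j = if j = k then w else zero3 := by
  unfold emb; rw [blk_eBlk_symm]

theorem blk_xstar (k : Fin 4) : blk xstar k = ones3 := rfl

/-- `(-1)^{u · e(k,w)} = (-1)^{u^k · w}`. [folklore] -/
theorem twist_emb (u : Fin (4 * 3) → Bool) (k : Fin 4) (w : V) : twist u (emb k w) = twist (blk u k) w := by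
  rw [twist_blocks]
  simp_rw [blk_emb]
  have e : ∀ j : Fin 4, twist (blk u j) (if j = k then w else zero3) = if j = k then twist (blk u k) w else 1 := by
    intro j
    split_ifs with h
    · subst h; rfl
    · exact twist_zero3_right _
  simp_rw [e]
  rw [prod_ite_eq' univ, if_pos (mem_univ _)]

/-- The sign pattern `P(u) = ∏_k ε(u^k) = (-1)^{z(u)}`. -/
def P (u : Fin (4 * 3) → Bool) : ℝ := ∏ k, eps (blk u k)

theorem sf_twist_xstar (u : Fin (4 * 3) → Bool) : signOf (fA u) * twist u xstar = P u := by
  rw [sf_eq, twist_blocks, ← prod_mul_distrib]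
  unfold P
  refine prod_congr rfl fun k _ => ?_
  exact eps_eq (blk u k)

theorem sum_P : ∑ u, P u = 1296 := by
  unfold P
  have key := sum_prod_blocks (fun _ v => eps v)
  rw [key]
  simp_rw [sum_eps]
  norm_num [prod_const]

theorem sum_P_twist (k : Fin 4) (w : V) (hw : w ≠ zero3) : ∑ u, P u * twist (blk u k) w = -432 := by
  have e : ∀ u : Fin (4 * 3) → Bool, P u * twist (blk u k) w =
      ∏ j, (eps (blk u j) * if j = k then twist (blk u j) w else 1) := by
    intro u
    unfold P
    rw [prod_mul_distrib, prod_ite_eq' univ, if_pos (mem_univ _)]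
  simp_rw [e]
  have key := sum_prod_blocks (fun j v => eps v * if j = k then twist v w else 1)
  rw [key]
  have inner : ∀ j : Fin 4, ∑ v : V, (eps v * if j = k then twist v w else 1) = if j = k then 2 else -6 := by
    intro j
    split_ifs
    · exact sum_eps_twist w hw
    · simp_rw [mul_one]; exact sum_eps
  simp_rw [inner]
  fin_cases k <;> simp [Fin.prod_univ_four] <;> norm_num

/-- The Walsh transform of `(-1)^b` factorises over the blocks. [folklore] -/
theorem W_sg (x : Fin (4 * 3) → Bool) :
    W (fun y => signOf (gB y)) x = ∏ k, W (fun v => signOf (c3 v)) (blk x k) := by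
  have key := W_blocks (fun _ v => signOf (c3 v)) x
  rw [← key]
  congr 1
  funext y
  exact sg_eq y

/-- The weight `w(u) = (-1)^{a(u)} W_b(u) = ∏_k m(u^k) = 6^{z(u)} 2^{4 - z(u)}`. [folklore] -/
theorem w_eq (u : Fin (4 * 3) → Bool) :
    signOf (fA u) * W (fun y => signOf (gB y)) u = ∏ k, mV (blk u k) := by
  rw [sf_eq, W_sg, ← prod_mul_distrib]
  exact prod_congr rfl fun k _ => mV_eq (blk u k)

theorem sum_w : ∑ u, signOf (fA u) * W (fun y => signOf (gB y)) u = 160000 := by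
  simp_rw [w_eq]
  have key := sum_prod_blocks (fun _ v => mV v)
  rw [key]
  simp_rw [sum_mV]
  norm_num [prod_const]

/-- The number of zero blocks of `u`. -/
def z (u : Fin (4 * 3) → Bool) : ℕ := (univ.filter fun k => blk u k = zero3).card

/-- `t(u) = z(u)` if `z(u)` is odd, `0` otherwise. -/
def t (u : Fin (4 * 3) → Bool) : ℝ := if Odd (z u) then (z u : ℝ) else 0

theorem z_eq_sum (u : Fin (4 * 3) → Bool) : (z u : ℝ) = ∑ k, (if blk u k = zero3 then (1 : ℝ) else 0) := by
  unfold z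
  rw [card_filter]
  push_cast
  rfl

/-- The two pattern inequalities, over the 16 zero-patterns of the blocks. [folklore] -/
theorem pattern_ineq (p : Fin 4 → Prop) [DecidablePred p] :
    48 * (if Odd (univ.filter p).card then ((univ.filter p).card : ℝ) else 0) ≤
        ∏ k, (if p k then (6 : ℝ) else 2) ∧
      -((∏ k, (if p k then (1 : ℝ) else -1)) * (univ.filter p).card) ≤
        (if Odd (univ.filter p).card then ((univ.filter p).card : ℝ) else 0) := by
  rw [card_filter, Fin.sum_univ_four, Fin.prod_univ_four, Fin.prod_univ_four]
  by_cases h0 : p 0 <;> by_cases h1 : p 1 <;> by_cases h2 : p 2 <;> by_cases h3 : p 3 <;>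
    simp [h0, h1, h2, h3] <;> norm_num [Nat.odd_iff]

theorem w_ge (u : Fin (4 * 3) → Bool) : 48 * t u ≤ ∏ k, mV (blk u k) := by
  have := (pattern_ineq (fun k => blk u k = zero3)).1
  unfold t z mV
  exact this

theorem negPz_le (u : Fin (4 * 3) → Bool) : -(P u * z u) ≤ t u := by
  have := (pattern_ineq (fun k => blk u k = zero3)).2
  unfold t z P eps
  exact this

/-! #### The YES bound -/

theorem sqrt_two_pow_36 : Real.sqrt ((2 : ℝ) ^ (3 * (4 * 3))) = 2 ^ 18 := by
  rw [show (2 : ℝ) ^ (3 * (4 * 3)) = (2 ^ 18) ^ 2 by norm_num, Real.sqrt_sq (by positivity)]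

theorem forrelation_eq (f g : (Fin (4 * 3) → Bool) → Bool) :
    forrelation f g = (2 ^ 18 : ℝ)⁻¹ * ∑ x, signOf (f x) * W (fun y => signOf (g y)) x := by
  rw [← phi_signOf, DerivativeWalsh.phi_eq_fsum, fsum_eq_sum_mul_W, sqrt_two_pow_36]

theorem yes_fA_gB : (3 : ℝ) / 5 ≤ forrelation fA gB := by
  rw [forrelation_eq, sum_w]; norm_num

/-! ### The refutation -/

open Summit.QuantumAdvantage.QuantumAdvantage.Theses.CubicForrelation in
/-- Refutes `CubicForrelation.CubicStability` [refuted-substantive]: the cubic pair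
`a = ∑_k [wt(x^k) = 2]`, `b = ∑_k x^k₁x^k₂x^k₃` on `n = 12` (4 blocks of 3 bits) has
`Φ = 625/1024 ≥ 3/5`, but no exactly forrelated pair `(f₀, g₀)` has `4·#{b ≠ g₀} ≤ 2¹²`
(no bent function lies within Hamming distance `2ⁿ/4` of `b`); witness above; repaired statement
missed by the witness: the same with YES threshold `2/3` (truth open). [folklore] -/
theorem cubicStability_refuted : ¬ CubicStability := by
  rw [CubicStability.Negative.cubicStability_iff]
  intro h
  obtain ⟨f₀, g₀, -, -, hex, -, hdg⟩ :=
    h (4 * 3) ⟨6, rfl⟩ fA gB isCubic_fA isCubic_gB yes_fA_gB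
  -- notation
  set sf : (Fin (4 * 3) → Bool) → ℝ := fun x => signOf (fA x) with hsf
  set sg : (Fin (4 * 3) → Bool) → ℝ := fun y => signOf (gB y) with hsg
  set sf0 : (Fin (4 * 3) → Bool) → ℝ := fun x => signOf (f₀ x) with hsf0
  set sg0 : (Fin (4 * 3) → Bool) → ℝ := fun y => signOf (g₀ y) with hsg0
  have hsf_sq : ∀ x, sf x ^ 2 = 1 := fun x => signOf_sq _
  have hsf0_sq : ∀ x, sf0 x ^ 2 = 1 := fun x => signOf_sq _
  have hsg0_sq : ∀ y, sg0 y ^ 2 = 1 := fun y => signOf_sq _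
  -- exactness ⇒ `g₀` bent with dual `f₀`, and `f₀` bent with dual `g₀`
  have hS : ∑ x, sf0 x * W sg0 x = 64 * 2 ^ (4 * 3) := by
    have e := forrelation_eq f₀ g₀
    rw [hex] at e
    have : ∑ x, signOf (f₀ x) * W (fun y => signOf (g₀ y)) x = 2 ^ 18 := by
      have h2 : (2 ^ 18 : ℝ) ≠ 0 := by positivity
      field_simp at e
      linarith
    rw [show (64 : ℝ) * 2 ^ (4 * 3) = 2 ^ 18 by norm_num]
    exact this
  have hWg0 : ∀ x, W sg0 x = 64 * sf0 x :=
    W_eq_of_fsum_eq sf0 sg0 hsf0_sq hsg0_sq 64 (by norm_num) hS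
  have hWf0 : ∀ u, W sf0 u = 64 * sg0 u := W_dual sf0 sg0 64 (by norm_num) (by norm_num) hWg0
  -- ρ = sf · sf0
  set ρ : (Fin (4 * 3) → Bool) → ℝ := fun x => sf x * sf0 x with hρ
  have hρsf : ∀ x, sf0 x = ρ x * sf x := by
    intro x
    have h1 : sf x ^ 2 = 1 := hsf_sq x
    have h2 : ρ x = sf x * sf0 x := rfl
    calc sf0 x = sf0 x * (sf x ^ 2) := by rw [h1, mul_one]
      _ = (sf x * sf0 x) * sf x := by ring
      _ = ρ x * sf x := by rw [h2]
  have hρle : ∀ x, 0 ≤ 1 - ρ x := by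
    intro x
    simp only [hρ, hsf, hsf0]
    cases fA x <;> cases f₀ x <;> norm_num [signOf]
  -- (B) closeness of `g₀` to `b`
  have hB : ∑ u, (1 - ρ u) * (sf u * W sg u) ≤ 28928 := by
    have hcorr : (2 : ℝ) ^ (4 * 3) / 2 ≤ ∑ y, sg y * sg0 y := by
      have e := two_pow_eq_corr_add gB g₀
      have hd : (4 : ℝ) * (CubicStability.Negative.hdist gB g₀ : ℝ) ≤ 2 ^ (4 * 3) := by
        exact_mod_cast hdg
      show (2 : ℝ) ^ (4 * 3) / 2 ≤ ∑ y, signOf (gB y) * signOf (g₀ y)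
      norm_num at e hd ⊢
      linarith
    have hplan := sum_W_mul_W sg sg0
    have e2 : ∑ x, W sg x * W sg0 x = 64 * ∑ x, ρ x * (sf x * W sg x) := by
      rw [mul_sum]
      refine sum_congr rfl fun x _ => ?_
      rw [hWg0 x, hρsf x]; ring
    have e3 : ∑ u, (1 - ρ u) * (sf u * W sg u) = ∑ u, sf u * W sg u - ∑ u, ρ u * (sf u * W sg u) := by
      rw [← sum_sub_distrib]; exact sum_congr rfl fun u _ => by ring
    rw [e3, show ∑ u, sf u * W sg u = 160000 from sum_w]
    have : (2 : ℝ) ^ (4 * 3) * (2 ^ (4 * 3) / 2) ≤ 64 * ∑ x, ρ x * (sf x * W sg x) := by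
      rw [← e2, hplan]
      exact mul_le_mul_of_nonneg_left hcorr (by positivity)
    norm_num at this
    linarith
  -- (X) bentness of `f₀` at `x*`
  have hX : ∑ u, (1 - ρ u) * P u ≤ 1360 := by
    have e1 : W sf0 xstar = ∑ u, ρ u * P u := by
      rw [show W sf0 xstar = ∑ u, sf0 u * twist u xstar from rfl]
      refine sum_congr rfl fun u _ => ?_
      rw [hρsf u, ← sf_twist_xstar u]; simp only [hsf]; ring
    have hb : -64 ≤ W sf0 xstar := by
      rw [hWf0]; simp only [hsg0]; nlinarith [neg_one_le_signOf (g₀ xstar)]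
    have e3 : ∑ u, (1 - ρ u) * P u = ∑ u, P u - ∑ u, ρ u * P u := by
      rw [← sum_sub_distrib]; exact sum_congr rfl fun u _ => by ring
    rw [e3, sum_P, ← e1]
    linarith
  -- (Y) bentness of `f₀` at `x* ⊕ e(k,w)`, summed over `w ≠ 0`
  have hY : ∀ k : Fin 4, ∑ u, (1 - ρ u) * P u * (if blk u k = zero3 then (1 : ℝ) else 0) ≤ -152 := by
    intro k
    have hYw : ∀ w : V, w ≠ zero3 → ∑ u, (1 - ρ u) * P u * twist (blk u k) w ≤ -368 := by
      intro w hw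
      have e1 : W sf0 (bxor xstar (emb k w)) = ∑ u, ρ u * P u * twist (blk u k) w := by
        rw [show W sf0 (bxor xstar (emb k w)) = ∑ u, sf0 u * twist u (bxor xstar (emb k w)) from rfl]
        refine sum_congr rfl fun u _ => ?_
        rw [twist_bxor_right, twist_emb, hρsf u, ← sf_twist_xstar u]; simp only [hsf]; ring
      have hb : -64 ≤ W sf0 (bxor xstar (emb k w)) := by
        rw [hWf0]; simp only [hsg0]; nlinarith [neg_one_le_signOf (g₀ (bxor xstar (emb k w)))]
      have e3 : ∑ u, (1 - ρ u) * P u * twist (blk u k) w =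
          ∑ u, P u * twist (blk u k) w - ∑ u, ρ u * P u * twist (blk u k) w := by
        rw [← sum_sub_distrib]; exact sum_congr rfl fun u _ => by ring
      rw [e3, sum_P_twist k w hw, ← e1]
      linarith
    -- sum over `w ∈ univ.erase zero3`
    have hsum : ∑ w ∈ univ.erase zero3, ∑ u, (1 - ρ u) * P u * twist (blk u k) w ≤ 7 * (-368) := by
      have hcard : (univ.erase (zero3 : V)).card = 7 := by rw [card_erase_of_mem (mem_univ _), card_univ, card_V]
      calc ∑ w ∈ univ.erase zero3, ∑ u, (1 - ρ u) * P u * twist (blk u k) w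
          ≤ ∑ w ∈ univ.erase (zero3 : V), (-368 : ℝ) :=
            sum_le_sum fun w hw => hYw w (ne_of_mem_erase hw)
        _ = 7 * (-368) := by rw [sum_const, hcard]; norm_num
    rw [sum_comm] at hsum
    have e4 : ∀ u : Fin (4 * 3) → Bool, ∑ w ∈ univ.erase zero3, (1 - ρ u) * P u * twist (blk u k) w =
        8 * ((1 - ρ u) * P u * (if blk u k = zero3 then (1 : ℝ) else 0)) - (1 - ρ u) * P u := by
      intro u
      rw [← mul_sum, sum_twist_erase]
      split_ifs <;> ring
    simp_rw [e4] at hsum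
    rw [sum_sub_distrib, ← mul_sum] at hsum
    linarith [hX]
  -- sum over the four blocks: `∑_u (1-ρ) P z ≤ -608`
  have hZ : ∑ u, (1 - ρ u) * P u * (z u : ℝ) ≤ -608 := by
    have e : ∀ u : Fin (4 * 3) → Bool, (1 - ρ u) * P u * (z u : ℝ) =
        ∑ k, (1 - ρ u) * P u * (if blk u k = zero3 then (1 : ℝ) else 0) := by
      intro u; rw [z_eq_sum, mul_sum]
    simp_rw [e]
    rw [sum_comm]
    calc ∑ k : Fin 4, ∑ u, (1 - ρ u) * P u * (if blk u k = zero3 then (1 : ℝ) else 0)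
        ≤ ∑ _k : Fin 4, (-152 : ℝ) := sum_le_sum fun k _ => hY k
      _ = -608 := by simp; norm_num
  -- pointwise pattern inequalities finish
  have hT : 608 ≤ ∑ u, (1 - ρ u) * t u := by
    have : ∑ u, -((1 - ρ u) * P u * (z u : ℝ)) ≤ ∑ u, (1 - ρ u) * t u := by
      refine sum_le_sum fun u _ => ?_
      have h1 := negPz_le u
      have h2 := hρle u
      nlinarith
    rw [sum_neg_distrib] at this
    linarith
  have hW : 48 * ∑ u, (1 - ρ u) * t u ≤ ∑ u, (1 - ρ u) * (sf u * W sg u) := by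
    rw [mul_sum]
    refine sum_le_sum fun u _ => ?_
    have h1 := w_ge u
    have h2 := hρle u
    have h3 : sf u * W sg u = ∏ k, mV (blk u k) := w_eq u
    rw [h3]
    nlinarith
  linarith

end CubicStabilityRefutation

/-- Refutes `CubicForrelation.CubicStability` [refuted-substantive]: at `n = 12` the cubic pair
`a = ∑_{k<4} [wt(x^{k}) = 2]`, `b = ∑_{k<4} x^k₁x^k₂x^k₃` (four blocks of three bits) is a YES instance,
`Φ(a,b) = 625/1024 ≥ 3/5` (Φ is multiplicative over blocks, `20/2^{4.5}` per block), yet NO bent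
function on `𝔽₂¹²` lies within Hamming distance `1024 = 2ⁿ/4` of `b` (Parseval, bentness of the dual
at the 29 Walsh points `1¹²`, `1¹² ⊕ e(k,w)`, and a weighted count), so no exactly forrelated pair
`(f₀,g₀)` satisfies `4·#{b ≠ g₀} ≤ 2¹²`; witness `(a, b)`; the repaired statement with YES threshold
`2/3` in place of `3/5` is missed by this witness (its truth is open). [folklore] -/
theorem CubicForrelationCubicStability_refuted :
    ¬ Summit.QuantumAdvantage.QuantumAdvantage.Theses.CubicForrelation.CubicStability :=
  CubicStabilityRefutation.cubicStability_refuted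

end Summit.QuantumAdvantage.QuantumAdvantage.Theorems
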